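import Mathlib
import HarnessLib
import Summits.BirchSwinnertonDyer.BirchSwinnertonDyer.Theses.TameQuarticManinParity
import Literature.NumberTheory.EllipticCurves.ManinConstantModularDegree
import Literature.NumberTheory.DiophantineGeometry.ConductorFactorizationProofs

/-!
# Birth skeleton (BC3) for crux `TprimeReducibleManinUnit` (stmt-BirchSwinnertonDyer-23737)

Route `TameQuarticManinParity` (W-ALL/3.T′), planner seat bsd-idea-3 (gen 3: ledger split LINE 9, items 24627/24628/24629),
director W-69 (4); file written by typer bsd-line-tqmp-ty1 (unit write_cruxes 23736/23737) as the exact twin of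
`Cruxes/TprimeIrreducibleManinUnit/Lines/birth.lean` (rev 2 e1cc354eeea7) with `¬ W.HasIrreducibleModPGaloisRep 3`.
The crux is FIXED (its decl is the route's). Split by the modular degree:

* `stub_cesnaviciusNeururerSaha` — the cite-only input: ČNS 2023 Thm 1.2, row "0 otherwise"
  (the tree's named fact `cesnaviciusNeururerSaha_padicVal_maninConstant_le_modularDegree`, statement only).
  On the (t′)-cell at `3` the conductor exponent is `2`, so `27 ∤ N` and the printed exceptional clause at `3`
  cannot apply (`not_pow_three_dvd_conductorNorm_of_subTprime`, PROVED below): the rows with `3 ∤ deg φ` follow.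
* `stub_tprimeRed_of_three_dvd_modularDegree` — the HARDEST stub, beyond ČNS Thm 1.2: the (t′)-rows at `3`
  with `E[3]` REDUCIBLE (a rational `3`-isogeny) AND `3 ∣ deg φ` (where `val₃(c) ≤ val₃(deg φ)` is void;
  ledger twin: item 24627 `TprimeRedManinUnitOfThreeDvdDegree` of route rev 2). Mechanism foreseen (route
  header): the parity/prolongation dichotomy of the irreducible twin without Edixhoven's §4 degree chain
  (`3 ∣ deg α` is possible here), i.e. the finite-flat argument must stand alone; the optimal curve may sit
  at either end of the `3`-isogeny.
* `TprimeReducibleManinUnit_of` — the kernel-checked composition: the crux decl itself, proved from the two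
  stubs invoked by name (case split on `3 ∣ deg φ`; no sorry of its own).
  (Shape as required by the skeleton audit: a closed theorem of the crux citing the declared stubs by name.)

Instrument row that would refute the hard stub: an optimal (t′)@3 curve with reducible `E[3]`, `3 ∣ deg φ`
and `3 ∣ c` — none with `N ≤ 5·10⁵` (Cremona: `c = 1` on all 6 698 reducible optimal (t′) classes, vet tk5e),
so a refuting row lies beyond `5·10⁵`. ČNS needs no irreducibility, so stub 1 is the same cite-only fact.
No summit statement is proved by this skeleton.
-/

open scoped BigOperators Topology Manifold Classical MeasureTheory ProbabilityTheory Matrix InnerProductSpace ComplexConjugate ContinuousMap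
open Filter Set Function TopologicalSpace MeasureTheory
open Literature

namespace Summit.BirchSwinnertonDyer.BirchSwinnertonDyer.Cruxes.TprimeReducibleManinUnit.Birth

open Summit.BirchSwinnertonDyer.BirchSwinnertonDyer.Theses.TameQuarticManinParity
open Summit.BirchSwinnertonDyer.Rank1Residual.Additive
open Literature.NumberTheory.EllipticCurves.ModularForms

/-- Helper (proved): on the census cell (t′) at `3` the conductor exponent is `2`, hence `3³ ∤ N`. -/
theorem not_pow_three_dvd_conductorNorm_of_subTprime (W : WeierstrassCurve ℚ) [W.IsElliptic]
    [W.IsGloballyMinimal] [NeZero (W.conductorNorm ℤ)] (h : SubTprime W 3) : ¬ 3 ^ 3 ∣ W.conductorNorm ℤ := by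
  have h2 : Summit.BirchSwinnertonDyer.Rank1Residual.Additive.condExp W 3 = 2 := h.2.1
  have hf : (W.conductorNorm ℤ).factorization (Rat.HeightOneSpectrum.natGenerator (placeOf 3)) =
      W.conductorExponent (placeOf 3) :=
    WeierstrassCurve.factorization_conductorNorm_holds W (placeOf 3)
  have hgen : Rat.HeightOneSpectrum.natGenerator (placeOf 3) = 3 :=
    congrArg Subtype.val ((Rat.HeightOneSpectrum.primesEquiv (R := ℤ)).apply_symm_apply ⟨3, Nat.prime_three⟩)
  intro hdvd
  have hN0 : W.conductorNorm ℤ ≠ 0 := NeZero.ne _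
  have hle : 3 ≤ (W.conductorNorm ℤ).factorization 3 :=
    (Nat.prime_three.pow_dvd_iff_le_factorization hN0).mp hdvd
  rw [hgen] at hf
  unfold Summit.BirchSwinnertonDyer.Rank1Residual.Additive.condExp at h2
  rw [hf, h2] at hle
  omega

/-- stub 1 (the cite-only input, M as a port / XL as a proof): Česnavičius–Neururer–Saha 2023, Thm 1.2,
row "0 otherwise": `val_p(c) ≤ val_p(deg φ)` outside the printed exceptional clauses at `2` and `3`.
This is VERBATIM the tree's named fact; it closes the (t′)@3 rows with `3 ∤ deg φ`. -/
theorem stub_cesnaviciusNeururerSaha :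
    cesnaviciusNeururerSaha_padicVal_maninConstant_le_modularDegree := by
  sorry

/-- stub 2 (HARDEST, L; beyond ČNS Thm 1.2): the (t′)-rows at `3` with `E[3]` REDUCIBLE and `3 ∣ deg φ`:
for a lattice-optimal, degree-minimal parametrisation datum `D` of a globally minimal non-CM `W` that is
additive at `3`, in census cell (t′) (`f₃ = 2`, `e ∤ 2`), with reducible `E[3]` and `3 ∣ deg φ`, `3 ∤ c(D)`
(verbatim the ledger item 24627 `TprimeRedManinUnitOfThreeDvdDegree`). -/
theorem stub_tprimeRed_of_three_dvd_modularDegree :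
    ∀ (W : WeierstrassCurve ℚ) [W.IsElliptic] [W.IsGloballyMinimal] [NeZero (W.conductorNorm ℤ)],
      ¬ W.HasCM → Literature.NumberTheory.EllipticCurves.Rank1Residual.Addv W 3 →
      Summit.BirchSwinnertonDyer.Rank1Residual.Additive.SubTprime W 3 → ¬ W.HasIrreducibleModPGaloisRep 3 →
      ∀ (D : Literature.NumberTheory.EllipticCurves.ModularForms.ModularParametrizationData W (W.conductorNorm ℤ)),
      (∀ z ∈ D.L.lattice, ∃ w ∈ Literature.NumberTheory.EllipticCurves.ModularForms.periodLattice D.f, z = D.c * w) →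
      (∀ (W' : WeierstrassCurve ℚ) [W'.IsElliptic]
          (D' : Literature.NumberTheory.EllipticCurves.ModularForms.ModularParametrizationData W' (W.conductorNorm ℤ)),
          D'.f = D.f → D.modularDegree ≤ D'.modularDegree) →
      3 ∣ D.modularDegree → ¬ (3 : ℤ) ∣ D.maninConstant := by
  sorry

/-- The kernel-checked composition: the two stubs, invoked BY NAME, give the crux (case split on
`3 ∣ deg φ`). The only `sorry`s of the file are inside the two stubs; this theorem is closed modulo them
(skeleton protocol: the hypotheses of the composition are exactly the declared stubs, each by name). -/
theorem TprimeReducibleManinUnit_of :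
    Summit.BirchSwinnertonDyer.BirchSwinnertonDyer.Theses.TameQuarticManinParity.TprimeReducibleManinUnit := by
  intro W _ _ _ hcm hadd ht hirr D hlat hmin
  by_cases hdeg : 3 ∣ D.modularDegree
  · exact stub_tprimeRed_of_three_dvd_modularDegree W hcm hadd ht hirr D hlat hmin hdeg
  · exact not_three_dvd_maninConstant_of_not_dvd_modularDegree stub_cesnaviciusNeururerSaha W D
      (Or.inl (not_pow_three_dvd_conductorNorm_of_subTprime W ht)) hdeg

end Summit.BirchSwinnertonDyer.BirchSwinnertonDyer.Cruxes.TprimeReducibleManinUnit.Birth
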